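import Summits.BirchSwinnertonDyer.BirchSwinnertonDyer.Theses.ErratumRoadFive
import Summits.BirchSwinnertonDyer.BirchSwinnertonDyer.Theorems.ErratumRoadFiveRest3ShaAnCertificate
import Summits.BirchSwinnertonDyer.BirchSwinnertonDyer.Theorems.ErratumRoadFiveRamNoErratumDataRung5015b1
import Summits.BirchSwinnertonDyer.BirchSwinnertonDyer.Theorems.ErratumRoadFiveRest3NoWitnessRung5595f1
import Summits.BirchSwinnertonDyer.BirchSwinnertonDyer.Theorems.ErratumRoadFiveRest3TorsionRung5190r1
import HarnessLib

/-!
# Route `ErratumRoadFive` (rung K2, `p ≥ 5`), crux `RamNoErratumDataAtFive` (item stmt-BirchSwinnertonDyer-19624, REST‴) BY NAME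
# from the `Ш_an` datum, and the three BC5 rungs (5015b1, 5595f1, 5190r1) from `#Ш_an = 1` ALONE
# (cell `bsd-stepL`, owner seat `bsd-stepL-rest-p2` g4; `--supports stmt-BirchSwinnertonDyer-19624`; THEOREMS ONLY — no definition,
# no named fact, no `sorry`)

HONEST FRAMING. Class-level packaging, over the route's support items `PublishedInputsFive` (19066; its Gross–Zagier, Kolyvagin,
Skinner 2016 Thm. C, GZK and modularity conjuncts are used) and `JSWAnticyclotomicControlMult` (19626), of the Theses-free tool
`ErratumRoadFiveRest3ShaAnCertificate.lean` (p512402): the per-pair certificate of REST‴ is the single datum `#Ш(E)_an = s ∈ ℚ`,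
`ord_p s ≤ 0` — the programme's record data binder (Cremona `allbsd`; here attested by TWO engines on all 703 204 REST‴ pairs
`N < 5·10⁵`, HOME/rest/SHA-CENSUS-REST3.md, kit j272588/j272590/j272591/j272592). Every published fact is a HYPOTHESIS; the datum is
attested per pair, never asserted; CLASS-WIDE it fails exactly where `Ш(E)[p] ≠ 0` granted BSD
(`shaAn_nonpos_iff_not_dvd_shaOrder_of_bsdp`) — a currency, not a road; BSD is proved for no pair; nothing booked (T7).

* §1 `openInputOnTreeAt_of_publishedInputsFive_of_shaAn_nonpos` (per pair, by the route's names);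
  `ramNoErratumDataAtFive_of_publishedInputsFive_of_shaAnNonpos` (the crux BY NAME ⟸ the two support items + the datum on the REST‴
  pairs) — hypothesis-wise it supersedes the owner's slack (p473288), GZ-sharp (p508874) and Kolyvagin-♯ (p447940, Locus, SZ14 PRE)
  packagings: no Heegner field, point, index, frame or preprint is asked, and no Tamagawa case split.
* §2 the rungs: the registered BC5 rung pairs `(5015b1, 5)` (Locus), `(5595f1, 5)` (REST⁗ ∩ (NW)) and the (T) rung `(5190r1, 5)` each
  from `PublishedInputsFive` + `JSWAnticyclotomicControlMult` + the ONE attested datum `#Ш_an = 1` (Cremona `allbsd`: 1.00000000; PARI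
  engine 2: integer `1` to ≥ 29 digits), the (ram) witness being kernel-decided (`ram_five_*`, landed). The earlier rung closers asked in
  ADDITION for a Heegner point / index certificate (p449825, p475167/p475571) or a `p`-adic regulator certificate (p453225, p453656).
  The (ram) witnesses are the landed kernel-decided `ram_five_*` of the rung files (imported; the gate's dedup rule forbids
  restating them, so this by-name file sits in the route's theses cone like `ErratumRoadFiveRest3SlackRungs.lean`).

References: [Miller2011LMS] Def. 1.1; [JetchevSkinnerWan2017] Thm. 3.3.1, §7.4.1; [Skinner2016PacificMC] Thm. C; [Castella2018Erratum]
Thm. 1.1 (iii)–(iv); [Cremona1997] Table 4 (5015b1, 5595f1, 5190r1: `#Ш_an = 1`).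
-/

-- the Theorems namespace of this sub repeats the summit name by design (D-0017 nested layout)
set_option linter.dupNamespace false
set_option autoImplicit false

noncomputable section

open scoped Classical

namespace Summit.BirchSwinnertonDyer.BirchSwinnertonDyer.Theorems

open WeierstrassCurve NumberField Literature.NumberTheory.EllipticCurves
  Literature.NumberTheory.EllipticCurves.Rank1Residual
  Literature.NumberTheory.EllipticCurves.Rank1Residual.Typed
  Summit.BirchSwinnertonDyer.Rank1Residual Summit.BirchSwinnertonDyer.Rank1Residual.X11b
  Summit.BirchSwinnertonDyer.BirchSwinnertonDyer.Theses.ErratumRoadFive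

/-! ## §1 By the route's names -/

/-- **Per pair, by the route's names**: `PublishedInputsFive` (support item 19066) + `JSWAnticyclotomicControlMult` (19626) + a (ram)
witness + the ONE datum `#Ш(E)_an = s`, `ord_p s ≤ 0` ⟹ route p2's open input at `(E, p)`. The record SHAPE of REST‴ over the route's
support items. CONDITIONAL; the datum is attested per pair, never asserted; nothing booked.
[cite: JetchevSkinnerWan2017, Thm. 3.3.1, §7.4.1 (pp. 30–31)] [cite: Skinner2016PacificMC, Thm. C (§1)] [cite: Miller2011LMS, Def. 1.1] -/
theorem openInputOnTreeAt_of_publishedInputsFive_of_shaAn_nonpos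
    (hF : PublishedInputsFive) (h331 : JSWAnticyclotomicControlMult)
    (W : WeierstrassCurve ℚ) [W.IsElliptic] [W.IsGloballyMinimal] (p : ℕ) [Fact p.Prime]
    (hram : Ram W p) {s : ℚ} (hs : shaAn W = (s : ℂ)) (hv : padicValRat p s ≤ 0) :
    P2OpenInputOnTreeAt W p := by
  obtain ⟨hGZ, hKo, -, hSk, -, hGZK, hmod, -, -, -, -, -, -, -, -⟩ := hF
  exact openInputOnTreeAt_of_shaAn_nonpos_of_thm331Mult W p h331 hGZ hKo hSk hGZK hmod hram hs hv

/-- **The crux `RamNoErratumDataAtFive` (item 19624) BY THE ROUTE'S NAMES ⟸ the `Ш_an` datum on the REST‴ pairs**: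
`PublishedInputsFive` + `JSWAnticyclotomicControlMult` + `hSha` (at every X11b pair with `p ≥ 5`, `ρ̄` onto, a (ram) witness and no
erratum datum: `#Ш(E)_an = s ∈ ℚ` with `ord_p s ≤ 0`) ⟹ `RamNoErratumDataAtFive`. CONDITIONAL; `hSha` is a per-pair data currency
(attested with 0 exceptions on the 703 204 REST‴ pairs `N < 5·10⁵` by two engines; FALSE class-wide exactly where `Ш(E)[p] ≠ 0`
granted BSD); nothing booked. [cite: Castella2018Erratum, Thm. 1.1 (iii)–(iv)] [cite: JetchevSkinnerWan2017, Thm. 3.3.1, §7.4.1]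
[cite: Skinner2016PacificMC, Thm. C (§1)] [cite: Miller2011LMS, Def. 1.1] -/
theorem ramNoErratumDataAtFive_of_publishedInputsFive_of_shaAnNonpos
    (hF : PublishedInputsFive) (h331 : JSWAnticyclotomicControlMult)
    (hSha : ∀ (W : WeierstrassCurve ℚ) [W.IsElliptic] [W.IsGloballyMinimal] (p : ℕ) [Fact p.Prime],
      ClassX11b W p → 5 ≤ p → Rank1Residual.Surj W p → Rank1Residual.Ram W p →
      ¬ ((∃ (q : ℕ) (_ : Fact q.Prime), q ≠ 2 ∧ q ≠ p ∧ Rank1Residual.Mult W q ∧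
          ¬ W.HasSplitMultiplicativeReductionAtPrime q ∧ ¬ p ∣ padicValInt q W.minimalDiscriminantInt) ∧
        (∀ P : (W.baseChange ℚ_[p]).toAffine.Point, p • P = 0 → P = 0)) →
      ∃ s : ℚ, shaAn W = (s : ℂ) ∧ padicValRat p s ≤ 0) :
    RamNoErratumDataAtFive := by
  obtain ⟨hGZ, hKo, -, hSk, -, hGZK, hmod, -, -, -, -, -, -, -, -⟩ := hF
  exact ramNoErratumDataAtFive_body_of_shaAnNonpos_of_thm331Mult h331 hGZ hKo hSk hGZK hmod hSha

/-- **The two registered regime stubs of skeleton v2 (d79431634e7b) from the route's names + the datum**, packaged as the pair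
(`Statement.stub_rest3_locus`, `Statement.stub_rest3_tam`) the composition `RamNoErratumDataAtFive_of` consumes: Locus form. CONDITIONAL;
data currency; nothing booked. [cite: JetchevSkinnerWan2017, Thm. 3.3.1] [cite: SkinnerZhang2014, Thm. 1.3 (the road NOT taken)] -/
theorem rest3Locus_of_publishedInputsFive_of_shaAnNonpos
    (hF : PublishedInputsFive) (h331 : JSWAnticyclotomicControlMult)
    (hSha : ∀ (W : WeierstrassCurve ℚ) [W.IsElliptic] [W.IsGloballyMinimal] (p : ℕ) [Fact p.Prime],
      ClassX11b W p → 5 ≤ p → Rank1Residual.Surj W p → Rank1Residual.Ram W p →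
      ¬ ((∃ (q : ℕ) (_ : Fact q.Prime), q ≠ 2 ∧ q ≠ p ∧ Rank1Residual.Mult W q ∧
          ¬ W.HasSplitMultiplicativeReductionAtPrime q ∧ ¬ p ∣ padicValInt q W.minimalDiscriminantInt) ∧
        (∀ P : (W.baseChange ℚ_[p]).toAffine.Point, p • P = 0 → P = 0)) →
      ¬ p ∣ W.tamagawaProduct → ∃ s : ℚ, shaAn W = (s : ℂ) ∧ padicValRat p s ≤ 0) :
    ∀ (W : WeierstrassCurve ℚ) [W.IsElliptic] [W.IsGloballyMinimal] (p : ℕ) [Fact p.Prime],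
      Literature.NumberTheory.EllipticCurves.Rank1Residual.Ram W p →
      ¬ ((∃ (q : ℕ) (_ : Fact q.Prime), q ≠ 2 ∧ q ≠ p ∧ Literature.NumberTheory.EllipticCurves.Rank1Residual.Mult W q ∧
          ¬ W.HasSplitMultiplicativeReductionAtPrime q ∧ ¬ p ∣ padicValInt q W.minimalDiscriminantInt) ∧
        (∀ P : (W.baseChange ℚ_[p]).toAffine.Point, p • P = 0 → P = 0)) →
      ¬ p ∣ W.tamagawaProduct →
      Summit.BirchSwinnertonDyer.Rank1Residual.X11b.P2OpenInputOnTreeAt W p := by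
  obtain ⟨hGZ, hKo, -, hSk, -, hGZK, hmod, -, -, -, -, -, -, -, -⟩ := hF
  exact rest3Locus_of_shaAnNonpos_of_thm331Mult h331 hGZ hKo hSk hGZK hmod hSha

/-- **Registered stub `stub_rest3_tam` (REST⁗) from the route's names + the datum on the REST⁗ pairs.** CONDITIONAL; data
currency; nothing booked. [cite: JetchevSkinnerWan2017, Thm. 3.3.1, §7.4.1] [cite: Castella2018Erratum, Thm. 1.1 (iii)–(iv)] -/
theorem rest3Tam_of_publishedInputsFive_of_shaAnNonpos
    (hF : PublishedInputsFive) (h331 : JSWAnticyclotomicControlMult)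
    (hSha : ∀ (W : WeierstrassCurve ℚ) [W.IsElliptic] [W.IsGloballyMinimal] (p : ℕ) [Fact p.Prime],
      ClassX11b W p → 5 ≤ p → Rank1Residual.Surj W p → Rank1Residual.Ram W p →
      ¬ ((∃ (q : ℕ) (_ : Fact q.Prime), q ≠ 2 ∧ q ≠ p ∧ Rank1Residual.Mult W q ∧
          ¬ W.HasSplitMultiplicativeReductionAtPrime q ∧ ¬ p ∣ padicValInt q W.minimalDiscriminantInt) ∧
        (∀ P : (W.baseChange ℚ_[p]).toAffine.Point, p • P = 0 → P = 0)) →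
      p ∣ W.tamagawaProduct → ∃ s : ℚ, shaAn W = (s : ℂ) ∧ padicValRat p s ≤ 0) :
    ∀ (W : WeierstrassCurve ℚ) [W.IsElliptic] [W.IsGloballyMinimal] (p : ℕ) [Fact p.Prime],
      Literature.NumberTheory.EllipticCurves.Rank1Residual.Ram W p →
      ¬ ((∃ (q : ℕ) (_ : Fact q.Prime), q ≠ 2 ∧ q ≠ p ∧ Literature.NumberTheory.EllipticCurves.Rank1Residual.Mult W q ∧
          ¬ W.HasSplitMultiplicativeReductionAtPrime q ∧ ¬ p ∣ padicValInt q W.minimalDiscriminantInt) ∧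
        (∀ P : (W.baseChange ℚ_[p]).toAffine.Point, p • P = 0 → P = 0)) →
      p ∣ W.tamagawaProduct →
      Summit.BirchSwinnertonDyer.Rank1Residual.X11b.P2OpenInputOnTreeAt W p := by
  obtain ⟨hGZ, hKo, -, hSk, -, hGZK, hmod, -, -, -, -, -, -, -, -⟩ := hF
  exact rest3Tam_of_shaAnNonpos_of_thm331Mult h331 hGZ hKo hSk hGZK hmod hSha

/-! ## §2 The three rungs from `#Ш_an = 1` alone -/

/-- **BC5 rung `(5015b1, 5)`** (registered `stub_rung_rest3_5015b1`'s pair; Locus, (NW): `N = 5015 = 5·17·59`, non-split at `5`,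
`17, 59` split `E[5]`-ramified witnesses, `∏c_ℓ = 2`, `r_an = 1`) from `PublishedInputsFive` + `JSWAnticyclotomicControlMult` + the ONE
attested datum `#Ш_an(5015b1) = 1` (Cremona `allbsd` 1.00000000; PARI engine 2 integer to ≥ 29 digits, kit j272588–92): route p2's open
input at the pair. The (ram) witness `17` is kernel-decided (`ram_five_5015b1`). No Heegner datum (cf. p449825 / p475571, which asked in
addition for the index certificate at `ℚ(√−179)`). CONDITIONAL; ONE pair; nothing booked.
[cite: Cremona1997, Table 4 (5015b1: #Ш_an = 1)] [cite: JetchevSkinnerWan2017, Thm. 3.3.1] [cite: Skinner2016PacificMC, Thm. C (§1)] -/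
theorem rung_5015b1_of_shaAn_eq_one
    [((⟨0, 0, 1, -248, 1503⟩ : WeierstrassCurve ℤ).baseChange ℚ).IsElliptic]
    [((⟨0, 0, 1, -248, 1503⟩ : WeierstrassCurve ℤ).baseChange ℚ).IsGloballyMinimal]
    (hF : PublishedInputsFive) (h331 : JSWAnticyclotomicControlMult)
    (hsha : shaAn ((⟨0, 0, 1, -248, 1503⟩ : WeierstrassCurve ℤ).baseChange ℚ) = ((1 : ℚ) : ℂ)) :
    Summit.BirchSwinnertonDyer.Rank1Residual.X11b.P2OpenInputOnTreeAt
      ((⟨0, 0, 1, -248, 1503⟩ : WeierstrassCurve ℤ).baseChange ℚ) 5 :=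
  openInputOnTreeAt_of_publishedInputsFive_of_shaAn_nonpos hF h331 _ 5 ram_five_5015b1 hsha (by simp)

/-- **Rung `(5595f1, 5)`** (registered `stub_rung_rest4_5595f1`'s pair; REST⁗ ∩ (NW): `N = 5595 = 3·5·373`, non-split at `5`, `c₃ = 5`,
`373` the split (ram) witness, `r_an = 1`) from `PublishedInputsFive` + `JSWAnticyclotomicControlMult` + the ONE attested datum
`#Ш_an(5595f1) = 1` (Cremona `allbsd`; PARI engine 2). No Heegner datum and no `p`-adic regulator (cf. p475167 slack datum at `ℚ(√−59)`,
p453656 REG5 certificate). CONDITIONAL; ONE pair; nothing booked.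
[cite: Cremona1997, Table 4 (5595f1: #Ш_an = 1)] [cite: JetchevSkinnerWan2017, Thm. 3.3.1, §7.4.1] [cite: Skinner2016PacificMC, Thm. C (§1)] -/
theorem rung_5595f1_of_shaAn_eq_one
    [((⟨1, 0, 0, -71, -234⟩ : WeierstrassCurve ℤ).baseChange ℚ).IsElliptic]
    [((⟨1, 0, 0, -71, -234⟩ : WeierstrassCurve ℤ).baseChange ℚ).IsGloballyMinimal]
    (hF : PublishedInputsFive) (h331 : JSWAnticyclotomicControlMult)
    (hsha : shaAn ((⟨1, 0, 0, -71, -234⟩ : WeierstrassCurve ℤ).baseChange ℚ) = ((1 : ℚ) : ℂ)) :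
    Summit.BirchSwinnertonDyer.Rank1Residual.X11b.P2OpenInputOnTreeAt
      ((⟨1, 0, 0, -71, -234⟩ : WeierstrassCurve ℤ).baseChange ℚ) 5 :=
  openInputOnTreeAt_of_publishedInputsFive_of_shaAn_nonpos hF h331 _ 5 ram_five_5595f1 hsha (by simp)

/-- **Rung `(5190r1, 5)`** (the (T)-branch rung of item 19702: `N = 5190 = 2·3·5·173`, SPLIT at `5` with `5 ∣ v₅(Δ) = c₅` and
`E(ℚ₅)[5] ≠ 0`, `r_an = 1`) from `PublishedInputsFive` + `JSWAnticyclotomicControlMult` + the ONE attested datum `#Ш_an(5190r1) = 1`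
(Cremona `allbsd`; PARI engine 2). No `p`-adic regulator (cf. p453225 / reg3-eng REG5CERT p479385 ff.) and no Heegner datum
(cf. p475167 slack datum at `ℚ(√−431)`). CONDITIONAL; ONE pair; nothing booked.
[cite: Cremona1997, Table 4 (5190r1: #Ш_an = 1)] [cite: JetchevSkinnerWan2017, Thm. 3.3.1, §7.4.1] [cite: Skinner2016PacificMC, Thm. C (§1)] -/
theorem rung_5190r1_of_shaAn_eq_one
    [((⟨1, 0, 0, -9535, 307097⟩ : WeierstrassCurve ℤ).baseChange ℚ).IsElliptic]
    [((⟨1, 0, 0, -9535, 307097⟩ : WeierstrassCurve ℤ).baseChange ℚ).IsGloballyMinimal]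
    (hF : PublishedInputsFive) (h331 : JSWAnticyclotomicControlMult)
    (hsha : shaAn ((⟨1, 0, 0, -9535, 307097⟩ : WeierstrassCurve ℤ).baseChange ℚ) = ((1 : ℚ) : ℂ)) :
    Summit.BirchSwinnertonDyer.Rank1Residual.X11b.P2OpenInputOnTreeAt
      ((⟨1, 0, 0, -9535, 307097⟩ : WeierstrassCurve ℤ).baseChange ℚ) 5 :=
  openInputOnTreeAt_of_publishedInputsFive_of_shaAn_nonpos hF h331 _ 5 ram_five_5190r1 hsha (by simp)

end Summit.BirchSwinnertonDyer.BirchSwinnertonDyer.Theorems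

end
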